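import Literature.AlgebraicTopology.SingularHomology.UniversalCoefficientsProofs
import Literature.AlgebraicTopology.SingularHomology.ChainSubcomplex
import HarnessLib

/-!
# The Kronecker map `Hⁿ⁺¹(X; R) → Hom(Hₙ₊₁(X; R), R)` is injective when `Hₙ(X; R) = 0`

Topic `Literature/AlgebraicTopology/SingularHomology`. The universal coefficient theorem
(A. Hatcher, *Algebraic Topology* (2002), §3.1 Thm. 3.2, p. 195, p. 197 over a principal ideal
domain) puts the Kronecker map `h` in the natural short exact sequence
`0 → Ext_R(Hₙ(X; R), R) → Hⁿ⁺¹(X; R) → Hom_R(Hₙ₊₁(X; R), R) → 0`; in particular **`h` is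
injective in degree `n + 1` as soon as `Hₙ(X; R) = 0`** (`Ext(0, R) = 0`). The tree proves the
two halves "`h` onto" and "`ker h` torsion when `Hₙ` is finitely generated"
(`UniversalCoefficientsProofs`); this file proves the vanishing case by the same argument with the
multiplier `a = 1` (Hatcher p. 193–195): a cocycle `φ` with `⟨[φ], -⟩ = 0` vanishes on the cycles
`Zₙ₊₁`, hence factors as `ψ ∘ ∂` through a functional `ψ` on the boundaries `Bₙ = ∂Cₙ₊₁ ⊆ Zₙ`;
when `Hₙ = 0` every cycle is a boundary, `Bₙ = Zₙ`, so `ψ` is defined on `Zₙ` and extends to `Cₙ`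
through the retraction `Cₙ → Zₙ` (`exists_retraction_ker_of_free`: `0 → Zₙ → Cₙ → Bₙ₋₁ → 0`
splits since `Bₙ₋₁` is free); the resulting cochain `χ` has `δχ = φ`, so `[φ] = 0`.

This is the form in which `H²` of a simply connected space (e.g. `ℂPⁿ`, `ℂP^∞`) is detected by
its second homology: `H²(X; ℤ) ↪ Hom(H₂(X; ℤ), ℤ)` when `H₁(X; ℤ) = 0`.

## Main statement (proved)

* `kroneckerPairing_injective_of_isZero`: `IsZero (Hₙ(X; R)) → Injective (h : Hⁿ⁺¹ → Hom(Hₙ₊₁, R))`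
  for every space, degree and principal ideal domain.
* `singularCohomology.eq_zero_of_forall_kroneckerPairing_eq_zero`: the elementwise form — a class
  of `Hⁿ⁺¹(X; R)` pairing to zero with every class of `Hₙ₊₁(X; R)` is zero, when `Hₙ(X; R) = 0`.

## References

* A. Hatcher, *Algebraic Topology*, CUP 2002, §3.1 pp. 191–195, Thm. 3.2 (p. 195), p. 197.
  [Hatcher2002]
-/

noncomputable section

open CategoryTheory Limits Submodule

universe u v

namespace Literature.AlgebraicTopology.SingularHomology

variable (R : Type v) [CommRing R] [IsDomain R] [IsPrincipalIdealRing R]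
  (X : Type u) [TopologicalSpace X]

open singularChainComplex singularCochainComplex

/-- **The Kronecker map is injective in degree `n + 1` when `Hₙ(X; R) = 0`** (Hatcher 2002,
§3.1 Thm. 3.2: `ker h = Ext(Hₙ(X; R), R)`, and `Ext(0, R) = 0`), for every space `X`, degree `n`
and principal ideal domain `R`. Proof as printed (pp. 193–195) with multiplier `1`: a cocycle
pairing to zero with all cycles factors through the boundaries `Bₙ`, which are all of `Zₙ` when
`Hₙ = 0`, and the factor extends to `Cₙ` through the retraction `Cₙ → Zₙ`; its coboundary is the
given cocycle. [cite: Hatcher2002, §3.1 Thm. 3.2 (p. 195)] -/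
theorem kroneckerPairing_injective_of_isZero (n : ℕ) (h0 : IsZero (singularHomology R R X n)) :
    Function.Injective (kroneckerPairing R R X (n + 1)) := by
  rw [← LinearMap.ker_eq_bot, Submodule.eq_bot_iff]
  intro x hx
  rw [LinearMap.mem_ker] at hx
  set K := singularChainComplex R R X with hK
  set j := (ComplexShape.down ℕ).next n with hj
  set Z : Submodule R (K.X n) := LinearMap.ker (K.d n j).hom with hZ
  have hdd : ∀ c : K.X (n + 1), (K.d (n + 1) n).hom c ∈ Z := fun c => LinearMap.mem_ker.mpr (by
    change (K.d (n + 1) n ≫ K.d n j) c = 0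
    rw [K.d_comp_d]
    rfl)
  set dZ : K.X (n + 1) →ₗ[R] Z := (K.d (n + 1) n).hom.codRestrict Z hdd with hdZ
  set B : Submodule R Z := LinearMap.range dZ with hB
  -- `Hₙ = 0`: every cycle is a boundary, `B = Z`
  have hBtop : ∀ z : Z, z ∈ B := by
    intro z
    obtain ⟨w, hw⟩ := (isZero_homology_iff K n).1 h0 (z : K.X n) (LinearMap.mem_ker.mp z.2)
    refine ⟨(K.XIsoOfEq (ChainComplex.prev ℕ n)).hom w, Subtype.ext ?_⟩
    change (K.d (n + 1) n).hom ((K.XIsoOfEq (ChainComplex.prev ℕ n)).hom w) = (z : K.X n)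
    rw [← hw, ← ModuleCat.comp_apply, K.XIsoOfEq_hom_comp_d]
  -- represent `x` by a cocycle `φ`
  induction x using singularCohomology_induction_on with
  | h φc =>
    set φ : SingularSimplex X (n + 1) → R := iCocycles R R X (n + 1) φc with hφ
    -- `φ` vanishes on `(n+1)`-cycles
    have hE : ∀ c : K.X (n + 1), (K.d (n + 1) n).hom c = 0 →
        (Finsupp.linearCombination R (φ) ∘ₗ (csingularChainComplex.compInv R R X _).hom) c = 0 := by
      intro c hc
      obtain ⟨z, rfl⟩ := exists_cycles_of_d_eq_zero (ChainComplex.next_nat_succ n) c hc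
      rw [hφ, ← kroneckerPairing_π_homologyπ, hx, LinearMap.zero_apply]
    -- `ψ : Bₙ → R` with `ψ (∂c) = φ(c)`
    have hker : LinearMap.ker dZ ≤ LinearMap.ker ((Finsupp.linearCombination R (φ) ∘ₗ
        (csingularChainComplex.compInv R R X _).hom)) := by
      intro c hc
      rw [LinearMap.mem_ker] at hc ⊢
      exact hE c (congrArg Subtype.val hc)
    let ψ : B →ₗ[R] R := (LinearMap.ker dZ).liftQ ((Finsupp.linearCombination R (φ) ∘ₗ
        (csingularChainComplex.compInv R R X _).hom)) hker ∘ₗ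
      dZ.quotKerEquivRange.symm.toLinearMap
    have hψ : ∀ c : K.X (n + 1), ψ ⟨dZ c, LinearMap.mem_range_self dZ c⟩ =
        (Finsupp.linearCombination R (φ) ∘ₗ (csingularChainComplex.compInv R R X _).hom) c := by
      intro c
      change (LinearMap.ker dZ).liftQ ((Finsupp.linearCombination R (φ) ∘ₗ
        (csingularChainComplex.compInv R R X _).hom)) hker (dZ.quotKerEquivRange.symm ⟨dZ c, _⟩) = _
      rw [LinearMap.quotKerEquivRange_symm_apply_image, Submodule.mkQ_apply, Submodule.liftQ_apply]
    -- `ψ` is defined on all of `Zₙ = Bₙ`; extend it to `Cₙ` through the retraction `p`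
    let toB : Z →ₗ[R] B := LinearMap.codRestrict B LinearMap.id hBtop
    let χ : Z →ₗ[R] R := ψ ∘ₗ toB
    have hχ : ∀ b : B, χ b = ψ b := fun b ↦ by
      change ψ (toB b) = ψ b
      congr 1
    haveI : Module.Free R (K.X j) := free_singularChainComplex_X R j
    obtain ⟨p, hp₁, hp₂⟩ := exists_retraction_ker_of_free (R := R) (K.d n j).hom
    let p' : K.X n →ₗ[R] Z := p.codRestrict Z fun c => LinearMap.mem_ker.mpr (hp₁ c)
    let L : K.X n →ₗ[R] R := χ ∘ₗ p'
    let χ' : SingularSimplex X n → R := fun σ => L (single (R := R) σ 1)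
    have hχ'L : (Finsupp.linearCombination R (χ') ∘ₗ (csingularChainComplex.compInv R R X _).hom) = L :=
      evalChain_apply_single_one L
    have hLd : ∀ c : K.X (n + 1), L ((K.d (n + 1) n).hom c) =
        (Finsupp.linearCombination R (φ) ∘ₗ (csingularChainComplex.compInv R R X _).hom) c := by
      intro c
      have hpc : p' ((K.d (n + 1) n).hom c) = dZ c :=
        Subtype.ext (hp₂ _ (LinearMap.mem_ker.mp (hdd c)))
      change χ (p' ((K.d (n + 1) n).hom c)) = _
      rw [hpc, show dZ c = ((⟨dZ c, LinearMap.mem_range_self dZ c⟩ : B) : Z) from rfl, hχ, hψ]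
    -- `δχ' = φ`
    have hδ : (singularCochainComplex R R X).d n (n + 1) χ' = φ := by
      refine singularCochainComplex.ext fun τ => ?_
      rw [← evalChain_single_one ((singularCochainComplex R R X).d n (n + 1) χ') τ, ← evalChain_d,
        hχ'L]
      change L ((K.d (n + 1) n).hom (single (R := R) τ 1)) = _
      rw [hLd, evalChain_single_one]
    -- hence `[φ] = [δχ'] = 0`
    have hcyc : φc = toCocycles R R X n (n + 1) χ' := by
      apply (ModuleCat.mono_iff_injective (iCocycles R R X (n + 1))).1 inferInstance
      change φ = (toCocycles R R X n (n + 1) ≫ iCocycles R R X (n + 1)) χ'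
      rw [HomologicalComplex.toCycles_i, hδ]
    rw [hcyc]
    change (toCocycles R R X n (n + 1) ≫ (singularCochainComplex R R X).homologyπ (n + 1)) χ' = 0
    rw [HomologicalComplex.toCycles_comp_homologyπ]
    rfl

/-- **A cohomology class of degree `n + 1` pairing to zero with all homology classes is zero,
when `Hₙ(X; R) = 0`** (elementwise form of `kroneckerPairing_injective_of_isZero`; Hatcher 2002,
§3.1 Thm. 3.2). [cite: Hatcher2002, §3.1 Thm. 3.2 (p. 195)] -/
theorem singularCohomology.eq_zero_of_forall_kroneckerPairing_eq_zero (n : ℕ)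
    (h0 : IsZero (singularHomology R R X n)) (x : singularCohomology R R X (n + 1))
    (hx : ∀ z : singularHomology R R X (n + 1), kroneckerPairing R R X (n + 1) x z = 0) : x = 0 :=
  kroneckerPairing_injective_of_isZero R X n h0
    (by rw [map_zero]; exact LinearMap.ext fun z ↦ by rw [hx, LinearMap.zero_apply])

end Literature.AlgebraicTopology.SingularHomology
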